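import Mathlib
import HarnessLib
import Summits.CriticalPhenomena.PercolationContinuityZ3.Theorems.PercNearOneGluingNoHeavyLowerTailTwoCopyLadderAllGradesLemmaQPos1
import Summits.CriticalPhenomena.PercolationContinuityZ3.Theorems.PercNearOneGluingNoHeavyLowerTailTwoCopyLadderAllGradesLemmaQPos2

/-!
# LEMMA Q — the symmetric double of every ladder side is nonnegative for `q ∈ [0,1]` (part 9 of 10)

Helper files for crux `stmt-CriticalPhenomena-4575` (new-inequality factory `prim-ineq-gen-1`, gen 20); memo
`run/shared/lean/prim/prim-ineq-gen-1/FINDING-28-lemma-Q-tower.md`.  Sequel to `…TwoCopyLadderAllGradesRung` (gen 19), which reduced the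
real-`q` rung theorem for ALL ladders (`Bhat q X Y ≥ 0`: Rayleigh negative correlation of the apex edge `av` of `L_r + av` with every rung
at every `0 < q < 1`) to LEMMA Q: `Qsym q X = Bhat q X X ≥ 0` on the orbit `Orb` of the q-moves (`rungStep`,
    `qpendU`, `qpendW`, `mergeUW`
from `triv`).  METHOD ("self-generated tower"): expanding `Qsym q (move_ρ X)` in powers of the new weight `ρ` produces quartic forms in
the five types; iterating,
    the LP closure over `q ∈ [0,1]` (multipliers and remainders in the Bernstein-type basis `qⁱ(1−q)ʲ`) terminates
with the 12 forms `Qsym, QU3, QU2, QU1, QU3W3, QU3S3, QU1S1` and the mirrors (`mir`,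
    `u ↔ w`) of the five non-symmetric ones: every
`ρ`-coefficient of every form under every move is a nonnegative combination of the 12 forms plus a polynomial that is manifestly
nonnegative for `0 ≤ q ≤ 1` and nonnegative entries (71 exact LP certificates, kit jobs j133358
    + j133934; every identity below is checked by
`ring`).  Hence all 12 forms are nonnegative along the orbit by one simultaneous induction (`goodL_of_orb`,
    last part) — LEMMA Q
(`Qsym_nonneg_of_orb`) — and, with `rung_allq_nonneg_of_Qsym` of gen 19,
    the unconditional real-`q` rung theorem `rung_allq_nonneg`.
NOT formalised: the identification of `Bhat`/`Orb` with the graph polynomials (memo FINDING-26 §1).  (This work,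
    2026-08-21.)
-/

namespace Summit.CriticalPhenomena.PercolationContinuityZ3.Theorems

namespace TwoCopyLadderAllGrades

open TwoCopyLadderCubic

variable {R : Type*} [CommRing R]

/-! ## LEMMA Q: positivity along the orbit -/

section Ordered

variable {S : Type*} [CommRing S] [LinearOrder S] [IsStrictOrderedRing S]

/-- The invariant of LEMMA Q along the orbit of the q-moves: nonnegative entries, the side forms `Aq`,
    `Dl` and their mirrors,
the symmetric double `Qsym` and the 6 further tower forms (with mirrors) are all nonnegative. [this work] -/

structure GoodL (q : S) (X : SVec S) : Prop where
  /-- `0 ≤ c` -/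
  hc : 0 ≤ X.c
  /-- `0 ≤ p` -/
  hp : 0 ≤ X.p
  /-- `0 ≤ m` -/
  hm : 0 ≤ X.m
  /-- `0 ≤ d` -/
  hd : 0 ≤ X.d
  /-- `0 ≤ s` -/
  hs : 0 ≤ X.s
  /-- `Aq ≥ 0` -/
  hA : 0 ≤ Aq q X
  /-- mirror `Aq ≥ 0` -/
  hAm : 0 ≤ Aq q (mir X)
  /-- `Dl ≥ 0` -/
  hD : 0 ≤ Dl X
  /-- mirror `Dl ≥ 0` -/
  hDm : 0 ≤ Dl (mir X)
  /-- the symmetric double is nonnegative -/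
  hQ : 0 ≤ Qsym q X
  /-- `QU3 ≥ 0` -/
  hU3 : 0 ≤ QU3 q X
  /-- mirror `QU3 ≥ 0` -/
  hU3m : 0 ≤ QU3 q (mir X)
  /-- `QU2 ≥ 0` -/
  hU2 : 0 ≤ QU2 q X
  /-- mirror `QU2 ≥ 0` -/
  hU2m : 0 ≤ QU2 q (mir X)
  /-- `QU1 ≥ 0` -/
  hU1 : 0 ≤ QU1 q X
  /-- mirror `QU1 ≥ 0` -/
  hU1m : 0 ≤ QU1 q (mir X)
  /-- `QU3W3 ≥ 0` -/
  hU3W3 : 0 ≤ QU3W3 q X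
  /-- `QU3S3 ≥ 0` -/
  hU3S3 : 0 ≤ QU3S3 q X
  /-- mirror `QU3S3 ≥ 0` -/
  hU3S3m : 0 ≤ QU3S3 q (mir X)
  /-- `QU1S1 ≥ 0` -/
  hU1S1 : 0 ≤ QU1S1 q X
  /-- mirror `QU1S1 ≥ 0` -/
  hU1S1m : 0 ≤ QU1S1 q (mir X)

omit [IsStrictOrderedRing S] in
/-- The invariant is mirror-symmetric. [this work] -/
theorem goodL_mir {q : S} {X : SVec S} (h : GoodL q X) : GoodL q (mir X) :=
  ⟨h.hc, h.hm, h.hp, h.hd,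
    h.hs, h.hAm, (by rw [mir_mir]; exact h.hA), h.hDm,
    (by rw [mir_mir]; exact h.hD), (by rw [Qsym_mir]; exact h.hQ), h.hU3m, (by rw [mir_mir]; exact h.hU3),
    h.hU2m, (by rw [mir_mir]; exact h.hU2), h.hU1m, (by rw [mir_mir]; exact h.hU1),
    (by rw [QU3W3_mir]; exact h.hU3W3), h.hU3S3m, (by rw [mir_mir]; exact h.hU3S3), h.hU1S1m,
    (by rw [mir_mir]; exact h.hU1S1)⟩

/-- The one-vertex side satisfies the invariant. [this work] -/
theorem goodL_triv (q : S) : GoodL q (triv : SVec S) := by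
  refine ⟨?_, ?_, ?_, ?_, ?_, ?_, ?_, ?_, ?_, ?_, ?_, ?_, ?_, ?_, ?_, ?_, ?_, ?_, ?_, ?_, ?_⟩ <;> simp only [triv,
      mir, Dl, Qsym, Bhat, Aq, Atq, QU3, QU3_c0, QU3_c1, QU2, QU2_c0, QU2_c1, QU1, QU1_c0, QU1_c1, QU3W3, QU3W3_c0,
      QU3W3_c1, QU3W3_c2, QU3S3, QU3S3_c0, QU3S3_c1, QU1S1, QU1S1_c0, QU1S1_c1, QU1S1_c2] <;> norm_num

/-- Step of LEMMA Q (`qpendU`, component `hc`). [this work] -/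
theorem goodL_qpendU_c {q ρ : S} (_hq : 0 ≤ q) (_hq1 : q ≤ 1) (hρ : 0 ≤ ρ) {X : SVec S} (h : GoodL q X) :
    0 ≤ (qpendU q ρ X).c := by
  obtain ⟨hc, -, -, -, -, -, -, -, -, -, -, -, -, -, -, -, -, -, -, -, -⟩ := h
  simp only [qpendU]; positivity

/-- Step of LEMMA Q (`qpendU`, component `hp`). [this work] -/
theorem goodL_qpendU_p {q ρ : S} (_hq : 0 ≤ q) (_hq1 : q ≤ 1) (hρ : 0 ≤ ρ) {X : SVec S} (h : GoodL q X) :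
    0 ≤ (qpendU q ρ X).p := by
  obtain ⟨-, hp, -, -, -, -, -, -, -, -, -, -, -, -, -, -, -, -, -, -, -⟩ := h
  simp only [qpendU]; positivity

/-- Step of LEMMA Q (`qpendU`, component `hm`). [this work] -/
theorem goodL_qpendU_m {q ρ : S} (hq : 0 ≤ q) (_hq1 : q ≤ 1) (hρ : 0 ≤ ρ) {X : SVec S} (h : GoodL q X) :
    0 ≤ (qpendU q ρ X).m := by
  obtain ⟨hc, -, hm, -, -, -, -, -, -, -, -, -, -, -, -, -, -, -, -, -, -⟩ := h
  simp only [qpendU]; positivity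

/-- Step of LEMMA Q (`qpendU`, component `hd`). [this work] -/
theorem goodL_qpendU_d {q ρ : S} (_hq : 0 ≤ q) (_hq1 : q ≤ 1) (hρ : 0 ≤ ρ) {X : SVec S} (h : GoodL q X) :
    0 ≤ (qpendU q ρ X).d := by
  obtain ⟨-, -, -, hd, -, -, -, -, -, -, -, -, -, -, -, -, -, -, -, -, -⟩ := h
  simp only [qpendU]; positivity

/-- Step of LEMMA Q (`qpendU`, component `hs`). [this work] -/
theorem goodL_qpendU_s {q ρ : S} (hq : 0 ≤ q) (_hq1 : q ≤ 1) (hρ : 0 ≤ ρ) {X : SVec S} (h : GoodL q X) :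
    0 ≤ (qpendU q ρ X).s := by
  obtain ⟨-, hp, -, hd, hs, -, -, -, -, -, -, -, -, -, -, -, -, -, -, -, -⟩ := h
  simp only [qpendU]; positivity

/-- Step of LEMMA Q (`qpendU`, component `hA`). [this work] -/
theorem goodL_qpendU_A {q ρ : S} (hq : 0 ≤ q) (_hq1 : q ≤ 1) (hρ : 0 ≤ ρ) {X : SVec S} (h : GoodL q X) :
    0 ≤ Aq q (qpendU q ρ X) := by
  obtain ⟨-, -, -, -, -, hA, -, -, -, -, -, -, -, -, -, -, -, -, -, -, -⟩ := h
  rw [Aq_qpendU]; positivity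

/-- Step of LEMMA Q (`qpendU`, component `hAm`). [this work] -/
theorem goodL_qpendU_Am {q ρ : S} (hq : 0 ≤ q) (_hq1 : q ≤ 1) (hρ : 0 ≤ ρ) {X : SVec S} (h : GoodL q X) :
    0 ≤ Aq q (mir (qpendU q ρ X)) := by
  obtain ⟨hc, hp, hm, hd, hs, -, hAm, -, -, -, -, -, -, -, -, -, -, -, -, -, -⟩ := h
  have hmc : 0 ≤ (mir X).c := hc
  have hmp : 0 ≤ (mir X).p := hm
  have hmm : 0 ≤ (mir X).m := hp
  have hmd : 0 ≤ (mir X).d := hd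
  have hms : 0 ≤ (mir X).s := hs
  rw [mir_qpendU, Aq_qpendW]; positivity

/-- Step of LEMMA Q (`qpendU`, component `hD`). [this work] -/
theorem goodL_qpendU_D {q ρ : S} (hq : 0 ≤ q) (_hq1 : q ≤ 1) (hρ : 0 ≤ ρ) {X : SVec S} (h : GoodL q X) :
    0 ≤ Dl (qpendU q ρ X) := by
  obtain ⟨hc, hp, -, -, -, -, -, hD, -, -, -, -, -, -, -, -, -, -, -, -, -⟩ := h
  rw [Dl_qpendU]; positivity

/-- Step of LEMMA Q (`qpendU`, component `hDm`). [this work] -/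
theorem goodL_qpendU_Dm {q ρ : S} (hq : 0 ≤ q) (_hq1 : q ≤ 1) (hρ : 0 ≤ ρ) {X : SVec S} (h : GoodL q X) :
    0 ≤ Dl (mir (qpendU q ρ X)) := by
  obtain ⟨hc, hp, -, hd, hs, -, -, -, hDm, -, -, -, -, -, -, -, -, -, -, -, -⟩ := h
  have hmc : 0 ≤ (mir X).c := hc
  have hmm : 0 ≤ (mir X).m := hp
  have hmd : 0 ≤ (mir X).d := hd
  have hms : 0 ≤ (mir X).s := hs
  rw [mir_qpendU, Dl_qpendW]; positivity

/-- Step of LEMMA Q (`qpendU`, component `hQ`). [this work] -/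
theorem goodL_qpendU_Q {q ρ : S} (_hq : 0 ≤ q) (_hq1 : q ≤ 1) (hρ : 0 ≤ ρ) {X : SVec S} (h : GoodL q X) :
    0 ≤ Qsym q (qpendU q ρ X) := by
  obtain ⟨-, -, -, -, -, -, -, -, -, hQ, hU3, -, hU2, -, hU1, -, -, -, -, -, -⟩ := h
  rw [Qsym_qpendU_exp]
  positivity

/-- Step of LEMMA Q (`qpendU`, component `hU3`). [this work] -/
theorem goodL_qpendU_U3 {q ρ : S} (hq : 0 ≤ q) (_hq1 : q ≤ 1) (hρ : 0 ≤ ρ) {X : SVec S} (h : GoodL q X) :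
    0 ≤ QU3 q (qpendU q ρ X) := by
  obtain ⟨-, -, -, -, -, -, -, -, -, -, hU3, -, hU2, -, hU1, -, -, -, -, -, -⟩ := h
  rw [QU3_qpendU_exp]
  positivity

/-- Step of LEMMA Q (`qpendU`, component `hU3m`). [this work] -/
theorem goodL_qpendU_U3m {q ρ : S} (hq : 0 ≤ q) (_hq1 : q ≤ 1) (hρ : 0 ≤ ρ) {X : SVec S} (h : GoodL q X) :
    0 ≤ QU3 q (mir (qpendU q ρ X)) := by
  obtain ⟨hc, hp, hm, hd, hs, -, -, -, -, -, -, hU3m, -, -, hU1, -, hU3W3, -, -, -, -⟩ := h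
  have hmc : 0 ≤ (mir X).c := hc
  have hmp : 0 ≤ (mir X).p := hm
  have hmm : 0 ≤ (mir X).m := hp
  have hmd : 0 ≤ (mir X).d := hd
  have hms : 0 ≤ (mir X).s := hs
  have hU3W3m : 0 ≤ QU3W3 q (mir X) := by rw [QU3W3_mir]; exact hU3W3
  rw [mir_qpendU, QU3_qpendW_exp]
  simp only [mir_mir]
  have hn_qpendWn2m : 0 ≤ QU3_qpendW_n2 q (mir X) := QU3_qpendW_n2_nonneg hq hmc hmp hmm hmd hms
  have hn_qpendWn1m : 0 ≤ QU3_qpendW_n1 q (mir X) := QU3_qpendW_n1_nonneg hq hmc hmp hmm hmd hms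
  positivity

/-- Step of LEMMA Q (`qpendU`, component `hU2`). [this work] -/
theorem goodL_qpendU_U2 {q ρ : S} (hq : 0 ≤ q) (_hq1 : q ≤ 1) (hρ : 0 ≤ ρ) {X : SVec S} (h : GoodL q X) :
    0 ≤ QU2 q (qpendU q ρ X) := by
  obtain ⟨-, -, -, -, -, -, -, -, -, -, -, -, hU2, -, hU1, -, -, -, -, -, -⟩ := h
  rw [QU2_qpendU_exp]
  positivity

/-- Step of LEMMA Q (`qpendU`, component `hU2m`). [this work] -/
theorem goodL_qpendU_U2m {q ρ : S} (hq : 0 ≤ q) (_hq1 : q ≤ 1) (hρ : 0 ≤ ρ) {X : SVec S} (h : GoodL q X) :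
    0 ≤ QU2 q (mir (qpendU q ρ X)) := by
  obtain ⟨hc, hp, hm, hd, hs, -, -, -, -, -, -, -, -, hU2m, -, hU1m, -, -, -, -, -⟩ := h
  have hmc : 0 ≤ (mir X).c := hc
  have hmp : 0 ≤ (mir X).p := hm
  have hmm : 0 ≤ (mir X).m := hp
  have hmd : 0 ≤ (mir X).d := hd
  have hms : 0 ≤ (mir X).s := hs
  rw [mir_qpendU, QU2_qpendW_exp]
  have hn_qpendWn3m : 0 ≤ QU2_qpendW_n3 q (mir X) := QU2_qpendW_n3_nonneg hq hmc hmp hmm hmd hms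
  have hn_qpendWn1m : 0 ≤ QU2_qpendW_n1 q (mir X) := QU2_qpendW_n1_nonneg hq hmc hmp hmm hmd hms
  have hn_qpendWn2m : 0 ≤ QU2_qpendW_n2 q (mir X) := QU2_qpendW_n2_nonneg hq hmc hmp hmm hmd hms
  positivity

/-- Step of LEMMA Q (`qpendU`, component `hU1`). [this work] -/
theorem goodL_qpendU_U1 {q ρ : S} (hq : 0 ≤ q) (_hq1 : q ≤ 1) (hρ : 0 ≤ ρ) {X : SVec S} (h : GoodL q X) :
    0 ≤ QU1 q (qpendU q ρ X) := by
  obtain ⟨-, -, -, -, -, -, -, -, -, -, -, -, -, -, hU1, -, -, -, -, -, -⟩ := h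
  rw [QU1_qpendU_exp]
  positivity

/-- Step of LEMMA Q (`qpendU`, component `hU1m`). [this work] -/
theorem goodL_qpendU_U1m {q ρ : S} (hq : 0 ≤ q) (_hq1 : q ≤ 1) (hρ : 0 ≤ ρ) {X : SVec S} (h : GoodL q X) :
    0 ≤ QU1 q (mir (qpendU q ρ X)) := by
  obtain ⟨hc, hp, hm, hd, hs, -, -, -, -, -, -, -, -, -, -, hU1m, -, -, -, -, -⟩ := h
  have hmc : 0 ≤ (mir X).c := hc
  have hmp : 0 ≤ (mir X).p := hm
  have hmm : 0 ≤ (mir X).m := hp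
  have hmd : 0 ≤ (mir X).d := hd
  have hms : 0 ≤ (mir X).s := hs
  rw [mir_qpendU, QU1_qpendW_exp]
  have hn_qpendWn3m : 0 ≤ QU1_qpendW_n3 q (mir X) := QU1_qpendW_n3_nonneg hq hmc hmp hmm hmd hms
  have hn_qpendWn1m : 0 ≤ QU1_qpendW_n1 q (mir X) := QU1_qpendW_n1_nonneg hq hmc hmp hmm hmd hms
  have hn_qpendWn2m : 0 ≤ QU1_qpendW_n2 q (mir X) := QU1_qpendW_n2_nonneg hq hmc hmp hmm hmd hms
  positivity

/-- Step of LEMMA Q (`qpendU`, component `hU3W3`). [this work] -/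
theorem goodL_qpendU_U3W3 {q ρ : S} (hq : 0 ≤ q) (_hq1 : q ≤ 1) (hρ : 0 ≤ ρ) {X : SVec S} (h : GoodL q X) :
    0 ≤ QU3W3 q (qpendU q ρ X) := by
  obtain ⟨hc, hp, hm, hd, hs, -, -, -, -, -, -, -, -, -, hU1, -, hU3W3, -, -, -, -⟩ := h
  rw [QU3W3_qpendU_exp]
  have hn_qpendUn1 : 0 ≤ QU3W3_qpendU_n1 q X := QU3W3_qpendU_n1_nonneg hq hc hp hm hd hs
  have hn_qpendUn2 : 0 ≤ QU3W3_qpendU_n2 q X := QU3W3_qpendU_n2_nonneg hq hc hp hm hd hs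
  have hn_qpendUn3 : 0 ≤ QU3W3_qpendU_n3 q X := QU3W3_qpendU_n3_nonneg hq hc hp hm hd hs
  positivity

/-- Step of LEMMA Q (`qpendU`, component `hU3S3`). [this work] -/
theorem goodL_qpendU_U3S3 {q ρ : S} (hq : 0 ≤ q) (hq1 : q ≤ 1) (hρ : 0 ≤ ρ) {X : SVec S} (h : GoodL q X) :
    0 ≤ QU3S3 q (qpendU q ρ X) := by
  obtain ⟨hc, hp, hm, hd, hs, -, -, -, -, hQ, hU3, -, hU2, -, hU1, -, -, hU3S3, -, hU1S1, -⟩ := h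
  have hq' : (0 : S) ≤ 1 - q := sub_nonneg.mpr hq1
  refine (mul_nonneg_iff_of_pos_left (by norm_num : (0 : S) < 2)).mp ?_
  rw [QU3S3_qpendU_exp]
  have hn_qpendUn3 : 0 ≤ QU3S3_qpendU_n3 q X := QU3S3_qpendU_n3_nonneg hq hq' hc hp hm hd hs
  have hn_qpendUn2 : 0 ≤ QU3S3_qpendU_n2 q X := QU3S3_qpendU_n2_nonneg hq hq' hc hp hm hd hs
  positivity

/-- Step of LEMMA Q (`qpendU`, component `hU3S3m`). [this work] -/
theorem goodL_qpendU_U3S3m {q ρ : S} (hq : 0 ≤ q) (hq1 : q ≤ 1) (hρ : 0 ≤ ρ) {X : SVec S} (h : GoodL q X) :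
    0 ≤ QU3S3 q (mir (qpendU q ρ X)) := by
  obtain ⟨hc, hp, hm, hd, hs, -, -, -, -, -, hU3, -, hU2, -, -, hU1m, hU3W3, -, hU3S3m, -, -⟩ := h
  have hq' : (0 : S) ≤ 1 - q := sub_nonneg.mpr hq1
  have hmc : 0 ≤ (mir X).c := hc
  have hmp : 0 ≤ (mir X).p := hm
  have hmm : 0 ≤ (mir X).m := hp
  have hmd : 0 ≤ (mir X).d := hd
  have hms : 0 ≤ (mir X).s := hs
  have hU3W3m : 0 ≤ QU3W3 q (mir X) := by rw [QU3W3_mir]; exact hU3W3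
  refine (mul_nonneg_iff_of_pos_left (by norm_num : (0 : S) < 2)).mp ?_
  rw [mir_qpendU, QU3S3_qpendW_exp]
  simp only [mir_mir]
  have hn_qpendWn2m : 0 ≤ QU3S3_qpendW_n2 q (mir X) := QU3S3_qpendW_n2_nonneg hq hmc hmp hmm hmd hms
  have hn_qpendWn1m : 0 ≤ QU3S3_qpendW_n1 q (mir X) := QU3S3_qpendW_n1_nonneg hq hmc hmp hmm hmd hms
  have hn_qpendWn0m : 0 ≤ QU3S3_qpendW_n0 q (mir X) := QU3S3_qpendW_n0_nonneg hq hmc hmp hmm hmd hms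
  have hn_qpendWn3m : 0 ≤ QU3S3_qpendW_n3 q (mir X) := QU3S3_qpendW_n3_nonneg hq hq' hmc hmp hmm hmd hms
  positivity

/-- Step of LEMMA Q (`qpendU`, component `hU1S1`). [this work] -/
theorem goodL_qpendU_U1S1 {q ρ : S} (hq : 0 ≤ q) (_hq1 : q ≤ 1) (hρ : 0 ≤ ρ) {X : SVec S} (h : GoodL q X) :
    0 ≤ QU1S1 q (qpendU q ρ X) := by
  obtain ⟨-, -, -, -, -, -, -, -, -, -, -, -, -, -, hU1, -, -, -, -, hU1S1, -⟩ := h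
  rw [QU1S1_qpendU_exp]
  positivity

/-- Step of LEMMA Q (`qpendU`, component `hU1S1m`). [this work] -/
theorem goodL_qpendU_U1S1m {q ρ : S} (hq : 0 ≤ q) (hq1 : q ≤ 1) (hρ : 0 ≤ ρ) {X : SVec S} (h : GoodL q X) :
    0 ≤ QU1S1 q (mir (qpendU q ρ X)) := by
  obtain ⟨hc, hp, hm, hd, hs, -, -, -, -, -, -, -, -, -, hU1, hU1m, hU3W3, -, -, -, hU1S1m⟩ := h
  have hq' : (0 : S) ≤ 1 - q := sub_nonneg.mpr hq1
  have hmc : 0 ≤ (mir X).c := hc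
  have hmp : 0 ≤ (mir X).p := hm
  have hmm : 0 ≤ (mir X).m := hp
  have hmd : 0 ≤ (mir X).d := hd
  have hms : 0 ≤ (mir X).s := hs
  have hU3W3m : 0 ≤ QU3W3 q (mir X) := by rw [QU3W3_mir]; exact hU3W3
  rw [mir_qpendU, QU1S1_qpendW_exp]
  simp only [mir_mir]
  have hn_qpendWn1m : 0 ≤ QU1S1_qpendW_n1 q (mir X) := QU1S1_qpendW_n1_nonneg hq hmc hmp hmm hmd hms
  have hn_qpendWn2m : 0 ≤ QU1S1_qpendW_n2 q (mir X) := QU1S1_qpendW_n2_nonneg hq hmc hmp hmm hmd hms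
  have hn_qpendWn0m : 0 ≤ QU1S1_qpendW_n0 q (mir X) := QU1S1_qpendW_n0_nonneg hq hmc hmp hmm hmd hms
  have hn_qpendWn3m : 0 ≤ QU1S1_qpendW_n3 q (mir X) := QU1S1_qpendW_n3_nonneg hq hq' hmc hmp hmm hmd hms
  positivity

/-- A q-pendant edge at `u` preserves the invariant (`0 ≤ q ≤ 1`, `0 ≤ ρ`). [this work] -/
theorem goodL_qpendU {q ρ : S} (hq : 0 ≤ q) (hq1 : q ≤ 1) (hρ : 0 ≤ ρ) {X : SVec S} (h : GoodL q X) :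
    GoodL q (qpendU q ρ X) :=
  ⟨goodL_qpendU_c hq hq1 hρ h, goodL_qpendU_p hq hq1 hρ h, goodL_qpendU_m hq hq1 hρ h, goodL_qpendU_d hq hq1 hρ h,
    goodL_qpendU_s hq hq1 hρ h, goodL_qpendU_A hq hq1 hρ h, goodL_qpendU_Am hq hq1 hρ h, goodL_qpendU_D hq hq1 hρ h,
    goodL_qpendU_Dm hq hq1 hρ h, goodL_qpendU_Q hq hq1 hρ h, goodL_qpendU_U3 hq hq1 hρ h,
        goodL_qpendU_U3m hq hq1 hρ h,
    goodL_qpendU_U2 hq hq1 hρ h, goodL_qpendU_U2m hq hq1 hρ h, goodL_qpendU_U1 hq hq1 hρ h,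
        goodL_qpendU_U1m hq hq1 hρ h,
    goodL_qpendU_U3W3 hq hq1 hρ h, goodL_qpendU_U3S3 hq hq1 hρ h, goodL_qpendU_U3S3m hq hq1 hρ h,
        goodL_qpendU_U1S1 hq hq1 hρ h,
    goodL_qpendU_U1S1m hq hq1 hρ h⟩

/-- A q-pendant edge at `w` preserves the invariant (by mirror symmetry). [this work] -/
theorem goodL_qpendW {q ρ : S} (hq : 0 ≤ q) (hq1 : q ≤ 1) (hρ : 0 ≤ ρ) {X : SVec S} (h : GoodL q X) :
    GoodL q (qpendW q ρ X) := by
  rw [qpendW_eq_mir]; exact goodL_mir (goodL_qpendU hq hq1 hρ (goodL_mir h))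

/-- Step of LEMMA Q (`rungStep`, component `hc`). [this work] -/
theorem goodL_rungStep_c {q ρ : S} (_hq : 0 ≤ q) (_hq1 : q ≤ 1) (hρ : 0 ≤ ρ) {X : SVec S} (h : GoodL q X) :
    0 ≤ (rungStep ρ X).c := by
  obtain ⟨hc, hp, hm, -, -, -, -, -, -, -, -, -, -, -, -, -, -, -, -, -, -⟩ := h
  simp only [rungStep]; positivity

omit [IsStrictOrderedRing S] in
/-- Step of LEMMA Q (`rungStep`, component `hp`). [this work] -/
theorem goodL_rungStep_p {q ρ : S} (_hq : 0 ≤ q) (_hq1 : q ≤ 1) (_hρ : 0 ≤ ρ) {X : SVec S} (h : GoodL q X) :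
    0 ≤ (rungStep ρ X).p := by
  obtain ⟨-, hp, -, -, -, -, -, -, -, -, -, -, -, -, -, -, -, -, -, -, -⟩ := h
  exact hp

omit [IsStrictOrderedRing S] in
/-- Step of LEMMA Q (`rungStep`, component `hm`). [this work] -/
theorem goodL_rungStep_m {q ρ : S} (_hq : 0 ≤ q) (_hq1 : q ≤ 1) (_hρ : 0 ≤ ρ) {X : SVec S} (h : GoodL q X) :
    0 ≤ (rungStep ρ X).m := by
  obtain ⟨-, -, hm, -, -, -, -, -, -, -, -, -, -, -, -, -, -, -, -, -, -⟩ := h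
  exact hm

/-- Step of LEMMA Q (`rungStep`, component `hd`). [this work] -/
theorem goodL_rungStep_d {q ρ : S} (_hq : 0 ≤ q) (_hq1 : q ≤ 1) (hρ : 0 ≤ ρ) {X : SVec S} (h : GoodL q X) :
    0 ≤ (rungStep ρ X).d := by
  obtain ⟨-, -, -, hd, hs, -, -, -, -, -, -, -, -, -, -, -, -, -, -, -, -⟩ := h
  simp only [rungStep]; positivity

omit [IsStrictOrderedRing S] in
/-- Step of LEMMA Q (`rungStep`, component `hs`). [this work] -/
theorem goodL_rungStep_s {q ρ : S} (_hq : 0 ≤ q) (_hq1 : q ≤ 1) (_hρ : 0 ≤ ρ) {X : SVec S} (h : GoodL q X) :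
    0 ≤ (rungStep ρ X).s := by
  obtain ⟨-, -, -, -, hs, -, -, -, -, -, -, -, -, -, -, -, -, -, -, -, -⟩ := h
  exact hs

/-- Step of LEMMA Q (`rungStep`, component `hA`). [this work] -/
theorem goodL_rungStep_A {q ρ : S} (_hq : 0 ≤ q) (_hq1 : q ≤ 1) (hρ : 0 ≤ ρ) {X : SVec S} (h : GoodL q X) :
    0 ≤ Aq q (rungStep ρ X) := by
  obtain ⟨-, -, -, -, -, hA, -, -, -, -, -, -, -, -, -, -, -, -, -, -, -⟩ := h
  rw [Aq_rungStep]; positivity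

/-- Step of LEMMA Q (`rungStep`, component `hAm`). [this work] -/
theorem goodL_rungStep_Am {q ρ : S} (_hq : 0 ≤ q) (_hq1 : q ≤ 1) (hρ : 0 ≤ ρ) {X : SVec S} (h : GoodL q X) :
    0 ≤ Aq q (mir (rungStep ρ X)) := by
  obtain ⟨-, -, -, -, -, -, hAm, -, -, -, -, -, -, -, -, -, -, -, -, -, -⟩ := h
  rw [Aq_mir_rungStep]; positivity

/-- Step of LEMMA Q (`rungStep`, component `hD`). [this work] -/
theorem goodL_rungStep_D {q ρ : S} (_hq : 0 ≤ q) (_hq1 : q ≤ 1) (hρ : 0 ≤ ρ) {X : SVec S} (h : GoodL q X) :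
    0 ≤ Dl (rungStep ρ X) := by
  obtain ⟨-, hp, -, -, hs, -, -, hD, -, -, -, -, -, -, -, -, -, -, -, -, -⟩ := h
  rw [Dl_rungStep]; positivity

end Ordered

end TwoCopyLadderAllGrades

end Summit.CriticalPhenomena.PercolationContinuityZ3.Theorems
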